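import Summits.Ventures.QEC.CircuitDistance.PortK2DataBB144Z
import Summits.Ventures.QEC.CircuitDistance.K2Chunks
import HarnessLib

/-!
# K2(`[[144,12,12]]`) chunk module — COMPUTATIONAL (native_decide; `Lean.ofReduceBool`)

Cell `qec`, CDX, R146/R152 STEP 1 («computational» header; `ofReduceBool` confined to these chunk modules). Checker of record
`K2.K2Data` (qec-cdx-type-1, PortK2Check); data module of record `PortK2DataBB144X/Z` (p669158/9, crit-1 data audit PASS
2026-08-28T21:20Z); chunk glue `K2Chunks` (idea-1 g2). Cube 0, child 7: leaf group 8 of 11.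
Leaf theorems: the K2 DFS accepts below one descendant state of pivot cube 0 (sector Z); sizes are exact DFS visit counts
(eng-1 g2 `k2count.c`), capped so that the gate's native-axiom audit re-verifies every leaf in place. Assemblies re-derive the
child lists in the kernel (`decide`) and end in the literal cube fact `d144Z.cube (Ts144Z.getD 0 []) (0) (lives144Z.getD 0 0) = true`
(the `hcubes` hypothesis of `K2Inst.k2_complete`). Emitted by qec-cdx-eng-1 g2 (`gen2.py`, idea-1's `gen_k2chunks_from_lean.py` lineage).
-/

namespace Summit.Ventures.QEC.CircuitDistance.K2

set_option maxRecDepth 100000 in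
set_option maxHeartbeats 0 in
set_option exponentiation.threshold 1024 in
/-- K2(144) chunk fact `cube144Z0_ch7_12` (683427 DFS visits; see the module docstring). -/
theorem cube144Z0_ch7_12 : app5 (d144Z.dfs (Ts144Z.getD 0 []) 6) (2952668565045107500544, 1448, 13479973333575319897424851395842996769206302513315053929280300908545, 3, 2348542582773833227889480596789337027375668226436652946151655999959769603177111952343022926177512416400637916) = true := by native_decide

set_option maxRecDepth 100000 in
set_option maxHeartbeats 0 in
set_option exponentiation.threshold 1024 in
/-- K2(144) chunk fact `cube144Z0_ch7_13` (615914 DFS visits; see the module docstring). -/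
theorem cube144Z0_ch7_13 : app5 (d144Z.dfs (Ts144Z.getD 0 []) 6) (593790603669545200640, 3562, 862718293348820473429435826636961362988776351823343087084044023758849, 3, 2348542582773833227889480596789337027374805508143304125678226655476984974995555563721501627858117100872663004) = true := by native_decide

set_option maxRecDepth 100000 in
set_option maxHeartbeats 0 in
set_option exponentiation.threshold 1024 in
/-- K2(144) chunk fact `cube144Z0_ch7_14` (710413 DFS visits; see the module docstring). -/
theorem cube144Z0_ch7_14 : app5 (d144Z.dfs (Ts144Z.getD 0 []) 6) (2952631973298170799104, 460, 56539106072908298546665520115117244839660917087750108704659087169859616769, 3, 2348542582773833227889480596789336970835699435235005579012706631703592468516070863701694967966718659508830172) = true := by native_decide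
end Summit.Ventures.QEC.CircuitDistance.K2
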